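import Literature.NumberTheory.Automorphic.AutomorphicInductionCharacterCubicProofs
import HarnessLib

/-!
# Non-normal cubic automorphic induction of a unitary Hecke character: the fact in the vocabulary
# of Arthur–Clozel's Definition 6.1, and its two clauses as weak automorphic inductions (proofs)

Topic `NumberTheory/Automorphic`; a proof file (theorems only: no definition, no named fact, no
instance) attached to the named fact
`Literature.NumberTheory.Automorphic.automorphicInduction_unitaryCharacter_cubic`
(`AutomorphicInductionUnitaryCharacterCubic`; Jacquet–Piatetski-Shapiro–Shalika 1979, §§13–14 —
the almost-everywhere converse theorem for `GL(3)` applied to the Hecke `L`-functions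
`L(s, θ · (ω ∘ N_{E/F}))` of a cubic, not necessarily Galois, extension `E/F` — as restated in
Gelbart 1997, Thm. 5.3.1 with Remarks 5.3.1 (a), (e) and §7.2, p. 258).

The sibling `AutomorphicInductionUnitaryCharacterCubicGaloisProofs` settles the GALOIS sub-case of
the fact from Arthur–Clozel's cyclic automorphic induction; the sibling
`AutomorphicInductionCharacterCubicProofs` shows that the finite-order fact
`automorphicInduction_character_cubic` is the finite-order case of this one and writes *that* fact
through Def. 6.1.  This file supplies the same Def. 6.1 form for the unitary fact itself, which is
the shape in which every source of the tree for automorphic induction is consumed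
(`automorphicInduction_cyclic`, `automorphicInduction_cyclic_cuspidal`: a representation `P` of
`GL_N(𝔸_F)` with `IsAutomorphicInductionAlong τ P` for an automorphic datum `τ` of `GL₁(𝔸_E)`):

* `automorphicInduction_unitaryCharacter_cubic_iff_isAutomorphicInductionAlong` — **the fact
  through Def. 6.1**: `automorphicInduction_unitaryCharacter_cubic` holds iff for every cubic
  `E/F` (no Galois hypothesis), every unitary Hecke character `θ` of `E` and every automorphic
  representation datum `τ` of `GL₁(𝔸_E)` with Satake parameters `{θ(ϖ_w)}` almost everywhere,
  (1) some automorphic `P` on `GL₃(𝔸_F)` is a weak automorphic induction of `τ` along `E/F`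
  (`IsAutomorphicInductionAlong τ P`: Arthur–Clozel 1989, Ch. 3, Def. 6.1 with (6.1)–(6.2),
  `det(X - t_{P,v}) = ∏_{w ∣ v} (X^{f(w|v)} - θ(ϖ_w))` for almost all `v`), and (2) under the
  fact's single-place regularity hypothesis some CUSPIDAL `P` is.  Forward through
  `isAutomorphicInductionAlong_iff_of_hasSatakeParamAt_singleton` (Def. 6.1 for `n = 1` is the
  character identity); backward with the datum `π_θ = ℂ·(θ∘det)/⊥`
  (`exists_automorphicRepData_hasSatakeParamAt_valueAtUniformizer`, typed by the proved
  compactness fact `isCompact_glFiniteIntegralLevel_holds 1 E`).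
* `automorphicInduction_unitaryCharacter_cubic.exists_isAutomorphicInductionAlong`,
  `automorphicInduction_unitaryCharacter_cubic.exists_cuspidal_isAutomorphicInductionAlong` — the
  two clauses of the fact as weak automorphic inductions of any such `τ`.

Nothing here discharges the fact (net debt unchanged).  Why no chain of named facts of the tree
reaches it for `E/F` NOT Galois (seat notes, 2026-08-15): the only functorial transfers the tree
carries are cyclic (Arthur–Clozel base change / automorphic induction, `exists_baseChange_cyclic`,
`automorphicInduction_cyclic(_cuspidal)`, `cuspidal_descent_cyclic`, `ArthurClozel_fibres_*`).
With `L` the Galois closure of `E/F` (group `S₃`) and `K/F` its quadratic resolvent, these produce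
`Π_K = AI_{L/K}(θ ∘ N_{L/E})` on `GL₃(𝔸_K)` and its two cuspidal descents `π₀`, `π₀ ⊗ η_{K/F}` to
`F`; at a place `v` of `F` inert in `K` (Frobenius a transposition, `v = w₁ w₂` in `E` with
`f = 1, 2`) they determine `t_{π₀,v} = {x, y, z}` only through `{x², y², z²} =
{θ(ϖ_{w₁})², θ(ϖ_{w₂}), θ(ϖ_{w₂})}` and (with the central character) `xyz = -θ(ϖ_{w₁}) θ(ϖ_{w₂})`,
which leaves the three candidates `{a, √b, -√b}` (the sought one), `{-a, √b, √b}`,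
`{-a, -√b, -√b}` (`a = θ(ϖ_{w₁})`, `b = θ(ϖ_{w₂})`); every base change through the cyclic layers
`K/F`, `L/K`, `L/E` only sees the places of `L`, of residue degree `2` over such `v`, i.e. the
squares again.  Pinning the sign at the density-`1/2` set of inert places is exactly the content of
the non-normal cubic lifting of Jacquet–Piatetski-Shapiro–Shalika (converse theorem for `GL(3)`
with their `GL(3) × GL(1)` / `GL(2) × GL(3)` Euler products), which has no carrier in the tree;
compare the identical diagnosis for non-normal cubic base change in `TunnellCubicLiftsLeaves`.

## References

* H. Jacquet, I. I. Piatetski-Shapiro, J. Shalika, *Automorphic forms on GL(3) II*, Ann. of Math.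
  109 (1979), 213–258, §§13–14. [JacquetPiatetskishapiroShalika1979II]
* S. Gelbart, *Three lectures on the modularity of `ρ̄_{E,3}` and the Langlands reciprocity
  conjecture*, in: Modular Forms and Fermat's Last Theorem (1997), Thm. 5.3.1, Remarks 5.3.1 (a),
  (e), §7.2 p. 258. [Gelbart1997]
* J. Arthur, L. Clozel, *Simple algebras, base change, and the advanced theory of the trace
  formula*, Ann. of Math. Stud. 120 (1989), Ch. 3, Def. 6.1, (6.1)–(6.2), Thm. 6.2.
  [ArthurClozelAMS120]
* A. Borel, H. Jacquet, *Automorphic forms and automorphic representations*, Proc. Sympos. Pure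
  Math. 33 (1979), part 1, §4.6. [BorelJacquet1979]
-/

noncomputable section

open scoped NumberField Polynomial Classical
open NumberField IsDedekindDomain Polynomial Filter Literature.NumberTheory.Automorphic

namespace Literature.NumberTheory.Automorphic

/-! ### The named fact through Def. 6.1 -/

/-- **Non-normal cubic automorphic induction of a unitary Hecke character, in the vocabulary of
Arthur–Clozel's Def. 6.1.** The named fact `automorphicInduction_unitaryCharacter_cubic`
(Jacquet–Piatetski-Shapiro–Shalika 1979, §§13–14; Gelbart 1997, Thm. 5.3.1 with Remark 5.3.1 (e))
holds iff: for every extension of number fields `E/F` of degree `3` (not assumed Galois), every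
unitary Hecke character `θ` of `E` and every automorphic representation datum `τ` of `GL₁(𝔸_E)`
with Satake parameters `{θ(ϖ_w)}` almost everywhere,
(1) there is an automorphic representation `P` of `GL₃(𝔸_F)` automorphically induced from `τ`
along `E/F` in the weak sense (`IsAutomorphicInductionAlong τ P`:
`det(X - t_{P,v}) = ∏_{w ∣ v} (X^{f(w|v)} - θ(ϖ_w))` for almost all `v`), and
(2) if `θ(ϖ_w) ≠ θ(ϖ_{w'})` for two places `w ≠ w'` above one `v`, of the same residue degree and
unramified for `θ`, there is such a `P` which is **cuspidal**.
Forward through `isAutomorphicInductionAlong_iff_of_hasSatakeParamAt_singleton`; backward with the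
datum `π_θ` (`exists_automorphicRepData_hasSatakeParamAt_valueAtUniformizer`, typed by the proved
compactness fact `isCompact_glFiniteIntegralLevel_holds 1 E`).  This is the shape in which a
source for the fact is to be consumed (compare `automorphicInduction_cyclic`,
`automorphicInduction_cyclic_cuspidal`).
[cite: JacquetPiatetskishapiroShalika1979II, §§13–14]
[cite: Gelbart1997, Thm. 5.3.1 and Remark 5.3.1 (e)]
[cite: ArthurClozelAMS120, Ch. 3 Def. 6.1 and (6.1)–(6.2)] -/
theorem automorphicInduction_unitaryCharacter_cubic_iff_isAutomorphicInductionAlong :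
    automorphicInduction_unitaryCharacter_cubic ↔
      ∀ (F E : Type) [Field F] [NumberField F] [Field E] [NumberField E] [Algebra F E],
        Module.finrank F E = 3 →
        ∀ (θ : GaloisRepresentations.HeckeCharacter E), θ.IsUnitary →
          ∀ (hE : isCompact_glFiniteIntegralLevel 1 E) (hF : isCompact_glFiniteIntegralLevel 3 F)
            (τ : AutomorphicRepData (AutomorphyDatum.gl 1 E hE)),
            (∀ᶠ w : HeightOneSpectrum (𝓞 E) in cofinite,
                τ.HasSatakeParamAt w {θ.valueAtUniformizer w}) →
              (∃ P : AutomorphicRepData (AutomorphyDatum.gl 3 F hF),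
                  IsAutomorphicInductionAlong τ P) ∧
              ((∃ (v : HeightOneSpectrum (𝓞 F)) (w w' : HeightOneSpectrum (𝓞 E)), w ≠ w' ∧
                  w.under (𝓞 F) = v ∧ w'.under (𝓞 F) = v ∧
                  w.asIdeal.inertiaDeg (𝓞 F) = w'.asIdeal.inertiaDeg (𝓞 F) ∧
                  θ.IsUnramifiedAt w ∧ θ.IsUnramifiedAt w' ∧
                  θ.valueAtUniformizer w ≠ θ.valueAtUniformizer w') →
                ∃ P : CuspidalAutomorphicRepData 3 F hF, IsAutomorphicInductionAlong τ P.1) := by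
  constructor
  · intro h F E _ _ _ _ _ h3 θ hθ hE hF τ hτ
    obtain ⟨h₁, h₂⟩ := h F E h3 θ hθ hF
    refine ⟨?_, fun hreg => ?_⟩
    · obtain ⟨P, hP⟩ := h₁
      exact ⟨P, (isAutomorphicInductionAlong_iff_of_hasSatakeParamAt_singleton θ hτ P).2 hP⟩
    · obtain ⟨P, hP⟩ := h₂ hreg
      exact ⟨P, (isAutomorphicInductionAlong_iff_of_hasSatakeParamAt_singleton θ hτ P.1).2 hP⟩
  · intro h F E _ _ _ _ _ h3 θ hθ hF
    obtain ⟨τ, hτ⟩ := exists_automorphicRepData_hasSatakeParamAt_valueAtUniformizer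
      (isCompact_glFiniteIntegralLevel_holds 1 E) θ
    obtain ⟨h₁, h₂⟩ := h F E h3 θ hθ _ hF τ hτ
    refine ⟨?_, fun hreg => ?_⟩
    · obtain ⟨P, hP⟩ := h₁
      exact ⟨P, (isAutomorphicInductionAlong_iff_of_hasSatakeParamAt_singleton θ hτ P).1 hP⟩
    · obtain ⟨P, hP⟩ := h₂ hreg
      exact ⟨P, (isAutomorphicInductionAlong_iff_of_hasSatakeParamAt_singleton θ hτ P.1).1 hP⟩

/-! ### The two clauses as weak automorphic inductions -/

section Along

variable {F E : Type} [Field F] [NumberField F] [Field E] [NumberField E] [Algebra F E]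
  {hE : isCompact_glFiniteIntegralLevel 1 E}

/-- **Clause (1) as a weak automorphic induction** (Gelbart 1997, Thm. 5.3.1, first sentence, with
Remark 5.3.1 (e); Arthur–Clozel's Def. 6.1 for `n = 1`): granting the fact, for `E/F` cubic (not
necessarily Galois), `θ` unitary and ANY automorphic representation datum `τ` of `GL₁(𝔸_E)` with
Satake parameters `{θ(ϖ_w)}` almost everywhere, some automorphic representation of `GL₃(𝔸_F)` is
automorphically induced from `τ` along `E/F` in the weak sense.
[cite: Gelbart1997, Thm. 5.3.1 and Remark 5.3.1 (e)]
[cite: ArthurClozelAMS120, Ch. 3 Def. 6.1] -/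
theorem automorphicInduction_unitaryCharacter_cubic.exists_isAutomorphicInductionAlong
    (h : automorphicInduction_unitaryCharacter_cubic) (h3 : Module.finrank F E = 3)
    (θ : GaloisRepresentations.HeckeCharacter E) (hθ : θ.IsUnitary)
    {τ : AutomorphicRepData (AutomorphyDatum.gl 1 E hE)}
    (hτ : ∀ᶠ w : HeightOneSpectrum (𝓞 E) in cofinite,
      τ.HasSatakeParamAt w {θ.valueAtUniformizer w})
    (hF : isCompact_glFiniteIntegralLevel 3 F) :
    ∃ P : AutomorphicRepData (AutomorphyDatum.gl 3 F hF), IsAutomorphicInductionAlong τ P :=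
  ((automorphicInduction_unitaryCharacter_cubic_iff_isAutomorphicInductionAlong.1 h)
    F E h3 θ hθ hE hF τ hτ).1

/-- **Clause (2) as a weak automorphic induction** (Gelbart 1997, Thm. 5.3.1, second sentence,
with Remark 5.3.1 (e); Arthur–Clozel's Def. 6.1 for `n = 1`): granting the fact, under its
single-place regularity hypothesis some CUSPIDAL representation of `GL₃(𝔸_F)` is automorphically
induced from `τ` along the cubic `E/F` in the weak sense.
[cite: Gelbart1997, Thm. 5.3.1 and Remark 5.3.1 (e)]
[cite: ArthurClozelAMS120, Ch. 3 Def. 6.1] -/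
theorem automorphicInduction_unitaryCharacter_cubic.exists_cuspidal_isAutomorphicInductionAlong
    (h : automorphicInduction_unitaryCharacter_cubic) (h3 : Module.finrank F E = 3)
    (θ : GaloisRepresentations.HeckeCharacter E) (hθ : θ.IsUnitary)
    (hreg : ∃ (v : HeightOneSpectrum (𝓞 F)) (w w' : HeightOneSpectrum (𝓞 E)), w ≠ w' ∧
      w.under (𝓞 F) = v ∧ w'.under (𝓞 F) = v ∧
      w.asIdeal.inertiaDeg (𝓞 F) = w'.asIdeal.inertiaDeg (𝓞 F) ∧
      θ.IsUnramifiedAt w ∧ θ.IsUnramifiedAt w' ∧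
      θ.valueAtUniformizer w ≠ θ.valueAtUniformizer w')
    {τ : AutomorphicRepData (AutomorphyDatum.gl 1 E hE)}
    (hτ : ∀ᶠ w : HeightOneSpectrum (𝓞 E) in cofinite,
      τ.HasSatakeParamAt w {θ.valueAtUniformizer w})
    (hF : isCompact_glFiniteIntegralLevel 3 F) :
    ∃ P : CuspidalAutomorphicRepData 3 F hF, IsAutomorphicInductionAlong τ P.1 :=
  ((automorphicInduction_unitaryCharacter_cubic_iff_isAutomorphicInductionAlong.1 h)
    F E h3 θ hθ hE hF τ hτ).2 hreg

end Along

end Literature.NumberTheory.Automorphic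

end
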